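import Literature.AlgebraicTopology.Homotopy.FreudenthalSuspension
import Literature.AlgebraicTopology.Homotopy.BasedMaps
import HarnessLib

/-!
# The equatorial reflection inverts suspensions: `R_* (E y) = (E y)⁻¹`

Topic `Literature/AlgebraicTopology/Homotopy`. For the hemisphere triad `Sⁿ⁺¹ = C₊ ∪ C₋`,
`C₊ ∩ C₋ = Sⁿ`, and the suspension homomorphism `E = j_*⁻¹ ∘ incl_* ∘ ∂⁻¹ : π(Sⁿ) → π(Sⁿ⁺¹)` of
`FreudenthalSuspension.lean` (Hatcher, *Algebraic Topology* (2002), Cor. 4.24 and its proof), the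
reflection `R` of `Sⁿ⁺¹` in the equatorial hyperplane (which fixes the equator pointwise and
exchanges the hemispheres) acts on the image of `E` by inversion:

* `Freudenthal.homotopyGroupMapOfEq_refl_triadSuspension` — **`R_* (E y) = (E y)⁻¹`**.

This is the group-level content of the classical statement that a map of degree `-1` of `Sⁿ⁺¹`
acts as `-1` on suspended classes (G. W. Whitehead, *Elements of Homotopy Theory* (1978), Ch. XI
§1–2; Hatcher 2002, §4.2, discussion of the suspension and Prop. 4L.? is not needed): with
`u = incl_* c`, `v = (R ∘ incl)_* c` in `π(Sⁿ⁺¹, Sⁿ)` for `∂c = y`, one has `∂u = ∂v`, so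
`u v⁻¹ = j w`; pushing into `π(Sⁿ⁺¹, C₋)` kills `v` and shows `w = E y`, pushing into
`π(Sⁿ⁺¹, C₊)` kills `u` and shows `j w = (R_* incl_* c)⁻¹ = (j R_* E y)⁻¹`. Also recorded:
`Freudenthal.refl_of_hgt_eq_zero` (the reflection fixes the equator) and
`Freudenthal.injective_ofAbsolute_up` (`j_* : π(Sⁿ⁺¹) → π(Sⁿ⁺¹, C₊)` is one-to-one).

Everything is proved; no named facts.

## References

* A. Hatcher, *Algebraic Topology*, CUP (2002), §4.2 Cor. 4.24 (proof, p. 360), Thm. 4.3.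
  [HatcherAT2002]
-/

noncomputable section

open Set Function Metric Topology unitInterval
open scoped Topology Topology.Homotopy

namespace Literature.AlgebraicTopology.Homotopy

namespace Freudenthal

open Hemi HemisphereExcision RelGenLoop

/-- Local notation: `𝔼 n` is the model Euclidean space `EuclideanSpace ℝ (Fin n)`. -/
local notation "𝔼 " n:arg => EuclideanSpace ℝ (Fin n)

/-- Local notation: `𝕊 n` is the unit sphere in `EuclideanSpace ℝ (Fin (n + 1))`. -/
local notation "𝕊 " n:arg => (Metric.sphere (0 : EuclideanSpace ℝ (Fin (n + 1))) 1)

variable {n : ℕ} {N : Type*} [Fintype N] [DecidableEq N]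

/-- **The equatorial reflection fixes the equator pointwise.** [folklore] -/
theorem refl_of_hgt_eq_zero {x : 𝕊 (n + 1)} (hx : hgt x = 0) : refl x = x :=
  eq_of_proj_eq (by rw [hgt_refl, hx, neg_zero]) (by rw [hx]) (proj_refl x)

/-- The reflection as a continuous self-map of `Sⁿ⁺¹`. [folklore] -/
abbrev reflMap : C(𝕊 (n + 1), 𝕊 (n + 1)) := ⟨refl, continuous_refl⟩

section

variable (s : N) (a : ↥(eqUp n))

/-- The reflection fixes the base point `â` of the suspension. [folklore] -/
theorem refl_loBase : refl ((loBase a : ↥(capLo : Set (𝕊 (n + 1)))) : 𝕊 (n + 1)) = (loBase a : ↥(capLo : Set (𝕊 (n + 1)))) :=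
  refl_of_hgt_eq_zero a.2

/-- **`j_* : π(Sⁿ⁺¹, b) → π(Sⁿ⁺¹, C₊, b)` is one-to-one** (`C₊` is contractible; exactness at
`π(Sⁿ⁺¹)`, Hatcher Thm. 4.3). [cite: HatcherAT2002, §4.2 Cor. 4.24 (proof, p. 360) with Thm. 4.3] -/
theorem injective_ofAbsolute_up [Nonempty N] [Nonempty { j // j ≠ s }] (b : Up n) :
    Function.Injective
      (RelHomotopyGroup.ofAbsolute s :
        HomotopyGroup N (𝕊 (n + 1)) (b : 𝕊 (n + 1)) → RelHomotopyGroup s (𝕊 (n + 1)) capUp b) := by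
  have hsub : ∀ x : Up n, Subsingleton (HomotopyGroup N (Up n) x) := fun x => by
    refine subsingleton_homotopyGroup_of_homotopyEquiv (ContractibleSpace.hequiv_unit (Up n)).some
      (fun u => ⟨fun p q => ?_⟩) x
    induction p using Quotient.inductionOn with
    | h p =>
      induction q using Quotient.inductionOn with
      | h q => exact congrArg _ (GenLoop.ext _ _ fun _ => Subsingleton.elim _ _)
  rw [← RelHomotopyGroup.coe_ofAbsoluteHom]
  refine (injective_iff_map_eq_one _).2 fun c hc => ?_
  have hc' : (RelHomotopyGroup.ofAbsolute s c : RelHomotopyGroup s (𝕊 (n + 1)) capUp b) = default := by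
    rw [← RelHomotopyGroup.one_eq_default]; exact hc
  obtain ⟨d, rfl⟩ := RelHomotopyGroup.exists_homotopyGroupIncl_eq c hc'
  have hd : d = ⟦GenLoop.const⟧ := Subsingleton.elim (h := hsub _) _ _
  rw [hd, homotopyGroupIncl_const, HomotopyGroup.one_def]

/-- **The equatorial reflection inverts suspensions: `R_* (E y) = (E y)⁻¹`** for every
`y ∈ π(Sⁿ, a)` (groups: `|N| ≥ 2`). [cite: HatcherAT2002, §4.2 Cor. 4.24 (proof, p. 360)] -/
theorem homotopyGroupMapOfEq_refl_triadSuspension [Nonempty N] [Nonempty { j // j ≠ s }]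
    (y : HomotopyGroup { j // j ≠ s } ↥(eqUp n) a) :
    homotopyGroupMapOfEq (N := N) reflMap (refl_loBase a).symm (triadSuspension s a y) =
      (triadSuspension s a y)⁻¹ := by
  -- the class `c` with `∂ c = y` and the defining property `j b = incl_* c` of `b = E y`
  set b := triadSuspension s a y with hb_def
  set c : RelHomotopyGroup s (Up n) (eqUp n) a := (boundaryIso s a).symm y with hc_def
  have hcy : RelHomotopyGroup.boundary c = y := by
    rw [← coe_boundaryIso s a]; exact (boundaryIso s a).apply_symm_apply y
  have hjb : RelHomotopyGroup.ofAbsolute s b = RelHomotopyGroup.map (incl n) mapsTo_incl_eqUp c := by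
    rw [hb_def, ← hcy]; exact ofAbsolute_triadSuspension_boundary s a c
  -- all base points are the point `pt = â` of `Sⁿ⁺¹`, in the equator, in `C₋` and in `C₊`
  have hR : (loBase a : 𝕊 (n + 1)) = reflMap (loBase a : 𝕊 (n + 1)) := (refl_loBase a).symm
  let ae : ↥(eqt : Set (𝕊 (n + 1))) := ⟨(loBase a : 𝕊 (n + 1)), by exact a.2⟩
  let ub : Up n := ⟨(loBase a : 𝕊 (n + 1)), by exact (a : Up n).2⟩
  have h_incl_eqt : MapsTo (incl n) (eqUp n) (eqt : Set (𝕊 (n + 1))) := fun x hx => hx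
  have h_Rincl_eqt : MapsTo (reflMap.comp (incl n)) (eqUp n) (eqt : Set (𝕊 (n + 1))) := fun x hx => by
    have hx' : hgt x.1 = 0 := hx
    show hgt (refl x.1) = 0
    rw [hgt_refl, hx', neg_zero]
  let u : RelHomotopyGroup s (𝕊 (n + 1)) eqt ae := RelHomotopyGroup.mapOfEq (incl n) h_incl_eqt rfl c
  let v : RelHomotopyGroup s (𝕊 (n + 1)) eqt ae :=
    RelHomotopyGroup.mapOfEq (reflMap.comp (incl n)) h_Rincl_eqt hR c
  -- `∂ u = ∂ v`: both are `∂ c` pushed into the equator, `R` fixing it pointwise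
  let ι : C(↥(eqUp n), ↥(eqt : Set (𝕊 (n + 1)))) :=
    ⟨fun x => ⟨x.1.1, x.2⟩, (continuous_subtype_val.comp continuous_subtype_val).subtype_mk _⟩
  have hduv : RelHomotopyGroup.boundary u = RelHomotopyGroup.boundary v := by
    show RelHomotopyGroup.boundary (RelHomotopyGroup.mapOfEq (incl n) h_incl_eqt rfl c) =
      RelHomotopyGroup.boundary (RelHomotopyGroup.mapOfEq (reflMap.comp (incl n)) h_Rincl_eqt hR c)
    rw [RelHomotopyGroup.boundary_mapOfEq (incl n) h_incl_eqt rfl ι (fun x => rfl) c,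
      RelHomotopyGroup.boundary_mapOfEq (reflMap.comp (incl n)) h_Rincl_eqt hR ι
        (fun x => (refl_of_hgt_eq_zero x.2).symm) c]
  -- hence `u v⁻¹ = j w`
  have hd1 : RelHomotopyGroup.boundary (u * v⁻¹) =
      (⟦GenLoop.const⟧ : HomotopyGroup { j // j ≠ s } ↥(eqt : Set (𝕊 (n + 1))) ae) := by
    rw [← RelHomotopyGroup.coe_boundaryHom, map_mul, map_inv, RelHomotopyGroup.coe_boundaryHom, hduv,
      mul_inv_cancel, HomotopyGroup.one_def]
  obtain ⟨w, hw⟩ := RelHomotopyGroup.exists_ofAbsolute_eq (u * v⁻¹) hd1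
  -- push into `(Sⁿ⁺¹, C₋)`: `v` dies, so `j w = incl_* c = j b`, `w = b`
  have h_eqt_lo : MapsTo (ContinuousMap.id (𝕊 (n + 1))) (eqt : Set (𝕊 (n + 1))) capLo :=
    fun x hx => le_of_eq hx
  let qlo := RelHomotopyGroup.mapOfEqHom (i := s) (a := ae) (b := loBase a)
    (ContinuousMap.id (𝕊 (n + 1))) h_eqt_lo rfl
  have hqu : qlo u = RelHomotopyGroup.map (incl n) mapsTo_incl_eqUp c := by
    show RelHomotopyGroup.mapOfEq _ _ _ (RelHomotopyGroup.mapOfEq _ _ _ c) = _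
    rw [RelHomotopyGroup.mapOfEq_mapOfEq, ← RelHomotopyGroup.mapOfEq_rfl]
    exact RelHomotopyGroup.mapOfEq_congr (ContinuousMap.id_comp _) _ _ _ _ c
  have hqv : qlo v = 1 := by
    show RelHomotopyGroup.mapOfEq _ _ _ (RelHomotopyGroup.mapOfEq _ _ _ c) = _
    rw [RelHomotopyGroup.mapOfEq_mapOfEq, RelHomotopyGroup.one_eq_default]
    refine RelHomotopyGroup.mapOfEq_eq_default_of_forall_mem _ _ _ (fun x => ?_) c
    show hgt (refl x.1) ≤ 0
    rw [hgt_refl]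
    have : 0 ≤ hgt x.1 := x.2
    linarith
  have hqw : qlo (RelHomotopyGroup.ofAbsolute s w) =
      (RelHomotopyGroup.ofAbsolute s w : RelHomotopyGroup s (𝕊 (n + 1)) capLo (loBase a)) := by
    show RelHomotopyGroup.mapOfEq _ _ _ _ = _
    rw [RelHomotopyGroup.mapOfEq_ofAbsolute, homotopyGroupMapOfEq_id]
  have hwb : w = b := by
    apply (bijective_ofAbsolute_lo s (loBase a)).1
    show (RelHomotopyGroup.ofAbsolute s w : RelHomotopyGroup s (𝕊 (n + 1)) capLo (loBase a)) =
      RelHomotopyGroup.ofAbsolute s b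
    rw [← hqw, hw, map_mul, map_inv, hqu, hqv, inv_one, mul_one, hjb]
  -- push into `(Sⁿ⁺¹, C₊)`: `u` dies, so `j w = (R_* incl_* c)⁻¹`
  have h_eqt_up : MapsTo (ContinuousMap.id (𝕊 (n + 1))) (eqt : Set (𝕊 (n + 1))) capUp :=
    fun x hx => ge_of_eq hx
  have h_Rincl_up : MapsTo (reflMap.comp (incl n)) (eqUp n) (capUp : Set (𝕊 (n + 1))) :=
    fun x hx => ge_of_eq (h_Rincl_eqt hx)
  let qup := RelHomotopyGroup.mapOfEqHom (i := s) (a := ae) (b := ub)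
    (ContinuousMap.id (𝕊 (n + 1))) h_eqt_up rfl
  have hqu' : qup u = 1 := by
    show RelHomotopyGroup.mapOfEq _ _ _ (RelHomotopyGroup.mapOfEq _ _ _ c) = _
    rw [RelHomotopyGroup.mapOfEq_mapOfEq, RelHomotopyGroup.one_eq_default]
    exact RelHomotopyGroup.mapOfEq_eq_default_of_forall_mem _ _ _ (fun x => x.2) c
  have hqv' : qup v = RelHomotopyGroup.mapOfEq (reflMap.comp (incl n)) h_Rincl_up hR c := by
    show RelHomotopyGroup.mapOfEq _ _ _ (RelHomotopyGroup.mapOfEq _ _ _ c) = _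
    rw [RelHomotopyGroup.mapOfEq_mapOfEq]
    exact RelHomotopyGroup.mapOfEq_congr (ContinuousMap.id_comp _) _ _ _ _ c
  have hqw' : qup (RelHomotopyGroup.ofAbsolute s w) =
      (RelHomotopyGroup.ofAbsolute s w : RelHomotopyGroup s (𝕊 (n + 1)) capUp ub) := by
    show RelHomotopyGroup.mapOfEq _ _ _ _ = _
    rw [RelHomotopyGroup.mapOfEq_ofAbsolute, homotopyGroupMapOfEq_id]
  have hup : (RelHomotopyGroup.ofAbsolute s w : RelHomotopyGroup s (𝕊 (n + 1)) capUp ub) =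
      (RelHomotopyGroup.mapOfEq (reflMap.comp (incl n)) h_Rincl_up hR c)⁻¹ := by
    rw [← hqw', hw, map_mul, map_inv, hqu', hqv', one_mul]
    rfl
  -- apply `R_*` to `j b = incl_* c`
  have hRlo_up : MapsTo reflMap (capLo : Set (𝕊 (n + 1))) capUp := fun x hx => by
    have hx' : hgt x ≤ 0 := hx
    show 0 ≤ hgt (refl x)
    rw [hgt_refl]; linarith
  have key : (RelHomotopyGroup.ofAbsolute s (homotopyGroupMapOfEq reflMap hR b) :
      RelHomotopyGroup s (𝕊 (n + 1)) capUp ub) =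
      RelHomotopyGroup.mapOfEq (reflMap.comp (incl n)) h_Rincl_up hR c :=
    calc (RelHomotopyGroup.ofAbsolute s (homotopyGroupMapOfEq reflMap hR b) :
          RelHomotopyGroup s (𝕊 (n + 1)) capUp ub)
        = RelHomotopyGroup.mapOfEq reflMap hRlo_up hR (RelHomotopyGroup.ofAbsolute s b) :=
          (RelHomotopyGroup.mapOfEq_ofAbsolute reflMap hRlo_up hR b).symm
      _ = RelHomotopyGroup.mapOfEq reflMap hRlo_up hR (RelHomotopyGroup.map (incl n) mapsTo_incl_eqUp c) :=
          congrArg (RelHomotopyGroup.mapOfEq reflMap hRlo_up hR) hjb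
      _ = RelHomotopyGroup.mapOfEq (reflMap.comp (incl n)) (hRlo_up.comp mapsTo_incl_eqUp) hR c :=
          RelHomotopyGroup.mapOfEq_map reflMap hRlo_up (incl n) mapsTo_incl_eqUp hR c
      _ = RelHomotopyGroup.mapOfEq (reflMap.comp (incl n)) h_Rincl_up hR c := rfl
  -- conclude by injectivity of `j` into `(Sⁿ⁺¹, C₊)`
  apply injective_ofAbsolute_up s ub
  show (RelHomotopyGroup.ofAbsolute s (homotopyGroupMapOfEq reflMap hR b) : RelHomotopyGroup s (𝕊 (n + 1)) capUp ub) =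
    (RelHomotopyGroup.ofAbsolute s b⁻¹ : RelHomotopyGroup s (𝕊 (n + 1)) capUp ub)
  rw [key, ← RelHomotopyGroup.coe_ofAbsoluteHom, map_inv, RelHomotopyGroup.coe_ofAbsoluteHom, ← hwb, hup]
  exact (inv_inv _).symm

end

end Freudenthal

end Literature.AlgebraicTopology.Homotopy

end
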